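import Summits.QuantumFields.BalabanUV.T4Continuum.Spine.NE4.MinimalInterface
import Literature.MathematicalPhysics.QuantumFieldTheory.Balaban1983to89.Beta.CouplingMatchingCarrier

/-!
# BalabanUVNodes ∕ N17 KNIT — DAG node N17 = spine estimate NE4 «scale-shift rate of the FULL β-functions» ON THE DATUM,
# BY NAME from each typed in-edge interface the tree has; the converse (why the node is DEPENDENT both ways); the round trip on the
# β-carrier (the in-edge interface is not stronger than the node); what N17 buys downstream; located negatives

TRACK A (YM-PLAN v0.12.15 §2c row NE4, node N17 of 28; HUMAN RULING D-0062), seat `pub-ymgap-dag-n17-a` (-a = KNIT-BY-NAME; director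
LINE №9∕№12, chair R429, lead ERRATUM to R420 (C) K4, dag-lead NODE-TABLE v1 row n17).  THEOREMS ONLY: def-free, sorry-free, standard axioms.
EVERYTHING MATHEMATICAL BELOW IS AN EXISTING KERNEL THEOREM OF THE TREE USED BY NAME; this file is the referee-facing ASSEMBLY of node N17
at Bałaban's finite-ε datum `D : T4Continuum.FiniteEpsData F G` — it proves no estimate of Bałaban's and moves no count.

## THE NODE.  Statement of record `T4CouplingMatching.ScaleShiftRate c θ γ β` (T4CouplingMatching.lean :180:
`∀ k, ∀ w ∈ ]0,γ]^{k+2}, |β (k+1) w − β k (Fin.tail w)| ≤ c·θ^k` — the β-function of the run with ONE MORE ultraviolet step, at the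
infrared-matched couplings, differs from the coarser run's by a geometric rate) AT THE DATUM'S OWN β-FAMILY: `Spine.NE4.NE4OnData D c θ γ :=
ScaleShiftRate c θ γ D.βfun` (Spine/NE4/Targets.lean :69; `NE4.ne4OnData_iff` is `Iff.rfl`).  Venue `YMDAG.N17 D c θ γ := NE4.NE4OnData D c θ γ`
(`HOME/lean/ym-dag/N17_NE4.lean`); cluster K4 «SpineRates» reads it at the DEPENDENT letters `N17At D u := NE4.NE4OnData D (u.cr·u.C₅·u.θ) u.ρ u.γ`
(dagwriter g75∕g77 `BalabanUVNodesSpineRates`, ns `YMDAG.UVSplit`, courier dag-p2 per R424 — NOT restated here: no carrier bundle, no `S_N17`, no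
`ReadOutAt` is declared in this file; every theorem below is over UNBUNDLED binders that are literally the fields of those bundles, so the glue of
record `N17_of_U3edge` is a one-line application of §1 either way the plan types N17 ((α) stub ∕ (β) glue)).
IN PRINT: NOTHING — [Balaban1987RG1] p. 264 «We will investigate other properties in a separate paper»; p. 298 names the history dependence only
(cell GAPS G-t4-U2-1 ∕ G-t4-U2-2).  NOT PROVED.  Class DEPENDENT (BALABAN-GAPS v1.0 §C l.50; ne4 census: «⇐ NE5 on Bałaban's objects ∧ (AF-0r); not
bypassable at node U2», `Spine/NE4/Necessity` p339922).

## IN-EDGES — the census this file makes kernel-explicit (lead ERRATUM to R420 (C), pub-ymgap INBOX l.8815: «there is no N15∕N16 → N17 arrow;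
## the only in-tree edge into `Spine.NE4.NE4OnData` is U3 → U2»; YM-PLAN's row «IN n15, n16, (D4)» is honoured in the only currency the tree has, §2)
| road | in-edge interface (BINDERS, by name) | theorem here | tree theorem it IS |
|---|---|---|---|
| U3, minimal | N18 = `T4OutputRate.NE5 EA (EB b) W κ θ C₅` for every first coupling `b ∈ ]0,γ]` of the finer run, + the (D4) β-READ-OUT binders: window ⊇ boxes, `RepresentsA EA rA γ D.βfun`, `RepresentsB EB rB γ D.βfun`, slice classes, `ReadCovariantOn` | `N17_of_ne5_readOut` (rate `θ`, constant `cr·C₅·θ`); `N17_of_ne5_readOut_oneRate` (the K4 letters `(cr·C₅·θ, ρ, γ)`, `ρ ≥ θ`) | `T4BetaReadOutLipschitz.scaleShiftRate_of_ne5_on` (+ `T4BetaReadOut.scaleShiftRate_mono`) |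
| U3, glue of record | the above + N22 = `T4OutputRate.NE9 EA W κ Λ ∧ FadingMemory C₉ ω Λ` + `ReadBoundedOn` + letter signs | `N17_of_u3edge` (N22 is IDLE for N17 proper — it serves only the companions `HistLipschitz`∕`FadingMemory` of node U2's triple, `u2Inputs_of_u3edge`) | `Spine.NE4.Targets.u2Inputs_of_u3` = `T4BetaReadOutLipschitz.ne4_of_u3_on_oneRate` |
| SPLIT («β⁰ conv + β¹ shift», the node's title) | the PRINTED one-loop split `S : B12Beta.OneLoopSplit D.βfun` ([Balaban1987RG1] (2.12)–(2.14) p. 268) with (AF-0r) `|β⁰_{k+1} − β⁰_∞| ≤ c₀θ^k` (GAPS G-an2-4; in N15 = NE2's currency: `Beta.LimitRate.KernelInputs` = k-uniform decay (5.10) + propagator∕kernel convergence WITH A RATE of the LINEAR theory) + the remainder's rate `RemainderShiftRate S c₁ θ γ` (the non-linear η-rate: N16 = NE3's minimisers and N18 = NE5's outputs live here) | `N17_of_split`, `N17_of_limitForm`, `N17_of_kernelInputs`, `N17_of_conv_ne5Remainder` | `T4CouplingMatching.scaleShiftRate_of_split`, `Beta.LimitRate.limitSplit_of_kernelInputs`,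 `T4BetaReadOut.scaleShiftRate_of_ne5_split` |
Converse (§3): `split_of_N17` — N17 ⟹ (AF-0r) ∧ β¹-rate under the (AF-1) corner bound (`Spine.NE4.AsymptoticContent.split_of_scaleShiftRate`): the node is
EXACTLY «(AF-0r) + the remainder's η-rate», not cheaper than G-an2-4 — DEPENDENT both ways.  Round trip (§4): on the β-CARRIER the minimal U3 interface is
EQUIVALENT to the node (`N17_iff_ne5_on_betaCarrier`), so §1's antecedent is inhabited whenever the node holds — no ex-falso, no smuggled strength.

## OUT-EDGES (§5, by name).  N17 → node U2's output under the targets' prefix (`NE4.u2Output_under`; → N19∕N27 through `T4MatchingAssembly.HybridNE7`),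
the continuum running coupling and tuned uniqueness (`NE4.continuumRunning_of_u2Inputs`, `NE4.tunedUniqueBelow_of_u2Inputs`); side edge → N25 (END ∕ binder
B3): `NE4.endpointExistence_of_ne4OnData`, `NE4.endpointExistence_of_ne4OnData_limPos`.  Here: `u2Output_under_of_u3edge` (END TO END from the glue's
in-edge list), `endpointExistence_of_N17` (the side edge verbatim) and `nodeU2_of_N17` (= `NE4.MinimalInterface.nodeU2_minimal`: N17 + relative real-analytic
charts of the β-sections — a printed TYPE, [Balaban1987RG1] p. 264 ∕ [Balaban1988RG2Cluster] (1.34) — + the printed upper bound ALREADY give node U2's output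
under the prefix, tuned uniqueness and the ∃ ⇒ ∀ passage: on that road N22's β-side role is absorbed by N17 + regularity).
OTHER TYPED ROADS INTO N17 (ne4 census (R42)–(R63); structural hypotheses on Bałaban's RT map, NOT DAG edges, not restated here):
`NE4.Markov.ne4_of_markov` ∕ `.ne4_of_stable` ∕ `.ne4_of_linearDefect` ∕ `.ne4_of_spectralRadius` ∕ `.ne4_of_stateAnalytic` (autonomous Markov-state
reading, `Spine/NE4/AutonomousScheme*.lean`), `NE4.ScaleShiftFrozenData.u2Inputs_of_frozenShift` (frozen-prefix settling × bounded live amplification),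
`T4FlagMemory.scaleShiftRate_of_scheme` (flag road).

## LOCATED NEGATIVES (§6, by name).  `not_N17_of_oscillating`: a datum whose β-family is the history-free oscillating family `β_{k+1} = s + c(−1)^k`
(`Beta.AveragedAFCarrier.Osc.betaO`, `0 < c`) violates N17 for EVERY constant and EVERY rate `θ < 1` (`Beta.CouplingMatchingCarrier.Osc.not_scaleShiftRate`)
although it carries every β-side grade the flow∕END nodes consume (`oscillating_betaWindow`: `BetaLowerH (s−c)`, `BetaUpperH (s+c)`, `BetaContH`) —
N17 is NOT implied by the β-window ∕ B3 ∕ B4 side of the DAG; `N17_of_betaZero`: at a datum with identically vanishing β-functions (the junk datum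
`T4FiniteEpsInhabited.stubData`'s `zeroHBeta`) N17 holds with constant 0 — the node has content only at Bałaban's β-functions (R422: no closed
K-item over a Stage-≤3 frame); finite-scale vacuity is `NE4.ne4OnData_of_eventually` (no finite table of β's bears on N17).

## WHAT THIS IS ∕ IS NOT.  IS: the kernel reading of node N17 from each of its typed in-edge interfaces, at an ARBITRARY finite-ε datum `D` (hence at
the datum of record of any NODE 00 stage and at the K4 rate carriers of record, by instantiation), with converse, round trip, out-edges and negatives
BY NAME.  IS NOT: a proof of NE4 for Bałaban's β-functions (every in-edge is a BINDER; rows NE5∕NE9∕(R)∕(AF-0r) are UNPRINTED and open); not a K4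
stub (no record predicate exists yet, R422); nothing about the continuum limit on ℝ⁴, infinite volume, OS axioms, a mass gap or the Clay problem —
one finite four-torus programme at fixed ε ([Balaban1989LargeFieldII] Thm 1 scope).
References (locators only): [Balaban1987RG1] = T. Bałaban, CMP **109** (1987) 249–301: (0.20) p. 256, Thm 2 p. 259, (1.20)–(1.22) p. 264,
(2.12)–(2.14) p. 268, (5.10) p. 293, p. 298; [King1986] = C. King, CMP **102** (1986), Thm 3.4 (3.9) p. 656 (TEMPLATE of the shape only).
-/

noncomputable section

namespace Summit.QuantumFields.YangMills.Theorems.BalabanUVNodesN17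

open Filter Topology
open Literature.MathematicalPhysics.QuantumFieldTheory.Balaban1983to89
open Literature.MathematicalPhysics.QuantumFieldTheory.Balaban1983to89.FlowStep
open Literature.MathematicalPhysics.QuantumFieldTheory.Balaban1983to89.T4CouplingMatching
open Literature.MathematicalPhysics.QuantumFieldTheory.Balaban1983to89.T4Continuum
open Literature.MathematicalPhysics.QuantumFieldTheory.Balaban1983to89.T4OutputRate (Carriers Functional Window NE5 NE9)
open Literature.MathematicalPhysics.QuantumFieldTheory.Balaban1983to89.T4BetaReadOut
  (Slice ReadOut RepresentsA RepresentsB ReadCovariant scaleShiftRate_mono scaleShiftRate_of_ne5 scaleShiftRate_of_ne5_split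
    betaEA betaEB betaRead representsA_beta representsB_beta readCovariant_beta ne5_beta_of_scaleShiftRate roundTrip_const
    extd_mem_window)
open Literature.MathematicalPhysics.QuantumFieldTheory.Balaban1983to89.T4BetaReadOutLipschitz
  (ReadBoundedOn ReadCovariantOn scaleShiftRate_of_ne5_on)
open Literature.MathematicalPhysics.QuantumFieldTheory.Balaban1983to89.T4FlagMemory (extd)
open Summit.QuantumFields.BalabanUV.T4Continuum.Spine
open Summit.QuantumFields.BalabanUV.T4Continuum.Spine.NE4 (NE4OnData U2Inputs U2Output)

universe u

variable {F : T4Family} {G : Type u} [GaugeGroup G] [MeasurableSpace G] [HaarData G]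

/-! ## §1 ROAD U3 — the node from N18 (NE5) and the (D4) β-read-out; the glue of record with N22 (NE9 ∧ fading memory) -/

section RoadU3

variable {C : Carriers} {W : Set (ℕ → ℝ)} {EA : Functional C C.BgA} {EB : ℝ → Functional C C.BgB}
  {𝒜A : Set (Slice C C.BgA)} {𝒜B : Set (Slice C C.BgB)} {rA : ReadOut C C.BgA} {rB : ReadOut C C.BgB}
  {γ κ θ C₅ C₉ ω cr ρ : ℝ} {Λ : ℕ → ℕ → ℝ}

/-- **N17 ⇐ N18 ∧ (D4), MINIMAL FORM (kernel, by name).**  At Bałaban's datum `D`: if run A's one-step output functional `EA` and run B's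
first-coupling family `EB b` on node U3's carriers `C` obey row NE5 for every unpaired first coupling `b ∈ ]0,γ]` (node N18, b-family form), the
coupling window `W` contains the γ-boxes, the datum's β-functions ARE the read-outs of the two runs' functionals (`RepresentsA`∕`RepresentsB` — the
linearity of (1.20)–(1.22) p. 264, the (D4) read-out binders) on slice classes where the read-out is transport-covariant with constant `cr`, then
`NE4OnData D (cr·C₅·θ) θ γ` — N17 AT NE5's OWN RATE `θ`.  `T4BetaReadOutLipschitz.scaleShiftRate_of_ne5_on` with `β := D.βfun`.  Row NE9 (N22), the
read-out bound `ReadBoundedOn` and all letter signs are NOT needed for N17 proper.  Every input UNPRINTED (rows NE5, (R)). [folklore] -/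
theorem N17_of_ne5_readOut (D : FiniteEpsData F G)
    (hW : ∀ k (v : Fin (k + 1) → ℝ), v ∈ Box γ k → extd v ∈ W)
    (h18 : ∀ b, 0 < b → b ≤ γ → NE5 EA (EB b) W κ θ C₅)
    (hA : RepresentsA EA rA γ D.βfun) (hB : RepresentsB EB rB γ D.βfun)
    (h𝒜A : ∀ g ∈ W, EA g ∈ 𝒜A) (h𝒜B : ∀ b, 0 < b → b ≤ γ → ∀ g ∈ W, EB b g ∈ 𝒜B)
    (hcov : ReadCovariantOn 𝒜A 𝒜B rA rB κ cr) :
    NE4OnData D (cr * C₅ * θ) θ γ :=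
  scaleShiftRate_of_ne5_on hW h18 hA hB h𝒜A h𝒜B hcov

/-- **N17 at cluster K4's DEPENDENT LETTERS `(cr·C₅·θ, ρ, γ)`** — the shape `YMDAG.UVSplit.N17At D u` reads: the minimal form at any joint rate
`ρ ≥ θ ≥ 0` (`cr, C₅ ≥ 0`; rates can always be worsened, `T4BetaReadOut.scaleShiftRate_mono`).  Still without N22. [folklore] -/
theorem N17_of_ne5_readOut_oneRate (D : FiniteEpsData F G)
    (hW : ∀ k (v : Fin (k + 1) → ℝ), v ∈ Box γ k → extd v ∈ W)
    (h18 : ∀ b, 0 < b → b ≤ γ → NE5 EA (EB b) W κ θ C₅)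
    (hA : RepresentsA EA rA γ D.βfun) (hB : RepresentsB EB rB γ D.βfun)
    (h𝒜A : ∀ g ∈ W, EA g ∈ 𝒜A) (h𝒜B : ∀ b, 0 < b → b ≤ γ → ∀ g ∈ W, EB b g ∈ 𝒜B)
    (hcov : ReadCovariantOn 𝒜A 𝒜B rA rB κ cr) (hcr : 0 ≤ cr) (hC₅ : 0 ≤ C₅) (hθ : 0 ≤ θ) (hθρ : θ ≤ ρ) :
    NE4OnData D (cr * C₅ * θ) ρ γ :=
  scaleShiftRate_mono (mul_nonneg (mul_nonneg hcr hC₅) hθ) hθ hθρ (N17_of_ne5_readOut D hW h18 hA hB h𝒜A h𝒜B hcov)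

/-- **NODE U2's WHOLE TRIPLE ⇐ (D4) ∧ N18 ∧ N22 (kernel, by name)** — what the glue of record `N17_of_U3edge` unpacks to: with ALSO row NE9 and
fading history moduli for run A's functional (node N22), the `cr`-bounded read-out and the letter signs, `Spine.NE4.Targets.u2Inputs_of_u3` gives
`U2Inputs D (cr·C₅·θ) (cr·C₉·ω) ρ γ (cr·Λ(·+1))` = N17 ∧ `HistLipschitz` ∧ `FadingMemory` at one rate `ρ ≥ max θ ω` — the β-side input node U2
actually consumes (`T4CouplingMatching.disc_le_of_fadingMemory`).  Restated so the binder list is on this page. [folklore] -/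
theorem u2Inputs_of_u3edge (D : FiniteEpsData F G)
    (hW : ∀ k (v : Fin (k + 1) → ℝ), v ∈ Box γ k → extd v ∈ W)
    (h18 : ∀ b, 0 < b → b ≤ γ → NE5 EA (EB b) W κ θ C₅) (h22 : NE9 EA W κ Λ ∧ T4OutputRate.FadingMemory C₉ ω Λ)
    (hA : RepresentsA EA rA γ D.βfun) (hB : RepresentsB EB rB γ D.βfun)
    (h𝒜A : ∀ g ∈ W, EA g ∈ 𝒜A) (h𝒜B : ∀ b, 0 < b → b ≤ γ → ∀ g ∈ W, EB b g ∈ 𝒜B)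
    (hr : ReadBoundedOn 𝒜A rA κ cr) (hcov : ReadCovariantOn 𝒜A 𝒜B rA rB κ cr) (hcr : 0 ≤ cr) (hC₅ : 0 ≤ C₅)
    (hθ : 0 ≤ θ) (hω : 0 ≤ ω) (hθρ : θ ≤ ρ) (hωρ : ω ≤ ρ) :
    U2Inputs D (cr * C₅ * θ) (cr * C₉ * ω) ρ γ (fun k i => cr * Λ (k + 1) i) :=
  NE4.u2Inputs_of_u3 D hW h18 h22.1 h22.2 hA hB h𝒜A h𝒜B hr hcov hcr hC₅ hθ hω hθρ hωρ

/-- **N17 ⇐ (D4) ∧ N18 ∧ N22 — THE GLUE OF RECORD's content** (R420 (C) erratum: «N17 = glue citing N18 ∧ N22 ∧ (D4) via `u2Inputs_of_u3`»;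
dagwriter `YMDAG.UVSplit.n17At_of_u3` ∕ `N17_of_U3edge`): the first component of `u2Inputs_of_u3edge`.  NOTE for the referee's binder census:
`h22`, `hr`, `hω`, `hωρ` are IDLE here (`N17_of_ne5_readOut_oneRate` proves the same conclusion without them) — they serve the companions only. [folklore] -/
theorem N17_of_u3edge (D : FiniteEpsData F G)
    (hW : ∀ k (v : Fin (k + 1) → ℝ), v ∈ Box γ k → extd v ∈ W)
    (h18 : ∀ b, 0 < b → b ≤ γ → NE5 EA (EB b) W κ θ C₅) (h22 : NE9 EA W κ Λ ∧ T4OutputRate.FadingMemory C₉ ω Λ)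
    (hA : RepresentsA EA rA γ D.βfun) (hB : RepresentsB EB rB γ D.βfun)
    (h𝒜A : ∀ g ∈ W, EA g ∈ 𝒜A) (h𝒜B : ∀ b, 0 < b → b ≤ γ → ∀ g ∈ W, EB b g ∈ 𝒜B)
    (hr : ReadBoundedOn 𝒜A rA κ cr) (hcov : ReadCovariantOn 𝒜A 𝒜B rA rB κ cr) (hcr : 0 ≤ cr) (hC₅ : 0 ≤ C₅)
    (hθ : 0 ≤ θ) (hω : 0 ≤ ω) (hθρ : θ ≤ ρ) (hωρ : ω ≤ ρ) :
    NE4OnData D (cr * C₅ * θ) ρ γ :=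
  (u2Inputs_of_u3edge D hW h18 h22 hA hB h𝒜A h𝒜B hr hcov hcr hC₅ hθ hω hθρ hωρ).ne4

end RoadU3

/-! ## §2 ROAD SPLIT — «β⁰ conv + β¹ shift»: the node from (AF-0r) of the printed one-loop split and the remainder's scale-shift rate -/

section RoadSplit

/-- **N17 ⇐ (AF-0r) ∧ β¹-RATE (kernel, by name).**  For the PRINTED one-loop split `S` of the datum's β-family (`β_{k+1} = β⁰_{k+1} + β¹_{k+1}(g_0,…,g_k)`,
[Balaban1987RG1] (2.12)–(2.14) p. 268, tree `B12Beta.OneLoopSplit`): if the one-loop coefficients converge geometrically, `|β⁰_{k+1} − β⁰_∞| ≤ c₀θ^k`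
((AF-0r), GAPS G-an2-4 — the field `conv` of `Beta.Assembly.LimitForm`; `0 ≤ θ ≤ 1`, `0 ≤ c₀`), and the remainder has the scale-shift rate
`RemainderShiftRate S c₁ θ γ` (T4CouplingMatching.lean :187), then `NE4OnData D (2c₀ + c₁) θ γ` — `T4CouplingMatching.scaleShiftRate_of_split` at
`β := D.βfun`.  Both inputs UNPRINTED. [cite: Balaban1987RG1, (2.12)-(2.14) p.268] -/
theorem N17_of_split (D : FiniteEpsData F G) (S : B12Beta.OneLoopSplit D.βfun) {binf c₀ c₁ θ γ : ℝ}
    (hθ0 : 0 ≤ θ) (hθ1 : θ ≤ 1) (hc₀ : 0 ≤ c₀) (hconv : ∀ k, |S.β0 k - binf| ≤ c₀ * θ ^ k)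
    (hrem : RemainderShiftRate S c₁ θ γ) : NE4OnData D (2 * c₀ + c₁) θ γ :=
  scaleShiftRate_of_split S hθ0 hθ1 hc₀ hconv hrem

/-- **N17 ⇐ the β sub-cell's LIMIT FORM ∧ β¹-rate.**  With the packaged one-loop limit form `Lf : Beta.Assembly.LimitForm D.βfun` of the β sub-cell
(binders B3∕B4's currency: split `Lf.S`, (AF-0r) `Lf.conv` at rate `Lf.θ`, constant `Lf.c₀`) and the remainder's rate for THAT split at THAT rate,
`NE4OnData D (2·Lf.c₀ + c₁) Lf.θ γ`. [folklore] -/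
theorem N17_of_limitForm (D : FiniteEpsData F G) (Lf : Beta.Assembly.LimitForm D.βfun) {c₁ γ : ℝ}
    (hrem : RemainderShiftRate Lf.S c₁ Lf.θ γ) : NE4OnData D (2 * Lf.c₀ + c₁) Lf.θ γ :=
  N17_of_split D Lf.S Lf.θ_nonneg Lf.θ_lt_one.le Lf.c₀_nonneg Lf.conv hrem

/-- **N17 ⇐ THE LINEAR THEORY's KERNEL RATE ∧ β¹-rate — YM-PLAN's in-edge «n15 (NE2)» in the only currency the tree has (kernel, by name).**
If the datum's one-loop coefficients are the second moments (1.22) of infinite-volume one-loop kernels `Π⁰_{k+1}` through a one-loop dictionary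
`Dict : Beta.OneLoopDictionary d c S`, and those kernels obey `Beta.LimitRate.KernelInputs` — k-uniform exponential decay (5.10) p. 293 and
CONVERGENCE WITH A GEOMETRIC RATE to a limit kernel (the η-rate of the LINEAR theory: propagators of the free block-spin theory, row NE2 = node N15's
subject; NOT PRINTED as a rate) —, then (AF-0r) holds with `β⁰_∞ = K.binf`, `c₀ = K.c₀`, `θ = K.θ` (`Beta.LimitRate.limitSplit_of_kernelInputs`), and
with the remainder's rate at `K.θ`: `NE4OnData D (2·K.c₀ + c₁) K.θ γ`. [cite: Balaban1987RG1, (1.22) p.264 and (5.10) p.293] -/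
theorem N17_of_kernelInputs (D : FiniteEpsData F G) {d c : ℕ} (S : B12Beta.OneLoopSplit D.βfun)
    (Dict : Beta.OneLoopDictionary d c S) (K : Beta.LimitRate.KernelInputs d Dict.limKernel) {c₁ γ : ℝ}
    (hrem : RemainderShiftRate S c₁ K.θ γ) : NE4OnData D (2 * K.c₀ + c₁) K.θ γ :=
  N17_of_split D S K.θ_nonneg K.θ_lt_one.le K.c₀_nonneg (Beta.LimitRate.limitSplit_of_kernelInputs Dict K) hrem

/-- **N17 ⇐ (AF-0r) ∧ N18 FOR THE REMAINDER (kernel, by name)** — the mixed road: (AF-0r) for the one-loop numbers, and row NE5 for REMAINDER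
term families `EA`, `EB b` (the instancer's one-step outputs minus their one-loop terms) whose read-outs represent `S.β1`, with a transport-covariant
read-out: `NE4OnData D (2c₀ + cr·C₅·θ) θ γ` (`T4BetaReadOut.scaleShiftRate_of_ne5_split`). [folklore] -/
theorem N17_of_conv_ne5Remainder (D : FiniteEpsData F G) (S : B12Beta.OneLoopSplit D.βfun) {C : Carriers} {W : Set (ℕ → ℝ)}
    {EA : Functional C C.BgA} {EB : ℝ → Functional C C.BgB} {rA : ReadOut C C.BgA} {rB : ReadOut C C.BgB}
    {γ κ θ C₅ cr binf c₀ : ℝ}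
    (hW : ∀ k (v : Fin (k + 1) → ℝ), v ∈ Box γ k → extd v ∈ W)
    (h18 : ∀ b, 0 < b → b ≤ γ → NE5 EA (EB b) W κ θ C₅)
    (hA : RepresentsA EA rA γ S.β1) (hB : RepresentsB EB rB γ S.β1) (hcov : ReadCovariant rA rB κ cr)
    (hθ0 : 0 ≤ θ) (hθ1 : θ ≤ 1) (hc₀ : 0 ≤ c₀) (hconv : ∀ k, |S.β0 k - binf| ≤ c₀ * θ ^ k) :
    NE4OnData D (2 * c₀ + cr * C₅ * θ) θ γ :=
  scaleShiftRate_of_ne5_split S hW h18 hA hB hcov hθ0 hθ1 hc₀ hconv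

end RoadSplit

/-! ## §3 THE CONVERSE — N17 ⟹ (AF-0r) ∧ β¹-rate: the node is EXACTLY «(AF-0r) + the remainder's η-rate» (DEPENDENT both ways) -/

section Converse

/-- **N17 ⟹ (AF-0r) ∧ β¹-RATE ON THE DATUM (kernel, by name).**  Under the corner bound (AF-1) `|β¹_{k+1}(p)| ≤ C·g_k` on the boxes (the shape
`B12Beta.af1_of_vanish_lipschitz` produces from the printed vanishing of (2.13) at `g_k = 0`), `NE4OnData D c θ γ` (`0 ≤ θ < 1`, `γ > 0`) yields a limit
`β⁰_∞` with `|β⁰_{k+1} − β⁰_∞| ≤ (c∕(1−θ))θ^k` AND `RemainderShiftRate S (c + 2c∕(1−θ)) θ γ` — `Spine.NE4.AsymptoticContent.split_of_scaleShiftRate` at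
`β := D.βfun`.  So no road to N17 is cheaper than (AF-0r) (G-an2-4): the dependency is two-way. [cite: Balaban1987RG1, (2.12)-(2.14) p.268] -/
theorem split_of_N17 (D : FiniteEpsData F G) (S : B12Beta.OneLoopSplit D.βfun) {C c γ θ : ℝ}
    (hγ : 0 < γ) (hθ0 : 0 ≤ θ) (hθ1 : θ < 1)
    (hAF1 : ∀ k (p : Fin (k + 1) → ℝ), p ∈ Box γ k → |S.β1 k p| ≤ C * p (Fin.last k))
    (h : NE4OnData D c θ γ) :
    ∃ binf : ℝ, (∀ k, |S.β0 k - binf| ≤ c / (1 - θ) * θ ^ k) ∧ RemainderShiftRate S (c + 2 * (c / (1 - θ))) θ γ :=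
  NE4.split_of_scaleShiftRate S hγ hθ0 hθ1 hAF1 h

/-- **N17 ⟺ (AF-0r) ∧ β¹-rate at a fixed rate** (constants existentially quantified; corner bound; `Spine.NE4.AsymptoticContent.scaleShiftRate_iff_split`
at `β := D.βfun`). [folklore] -/
theorem N17_iff_split (D : FiniteEpsData F G) (S : B12Beta.OneLoopSplit D.βfun) {C γ θ : ℝ}
    (hγ : 0 < γ) (hθ0 : 0 ≤ θ) (hθ1 : θ < 1)
    (hAF1 : ∀ k (p : Fin (k + 1) → ℝ), p ∈ Box γ k → |S.β1 k p| ≤ C * p (Fin.last k)) :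
    (∃ c, NE4OnData D c θ γ) ↔
      (∃ binf c₀ : ℝ, 0 ≤ c₀ ∧ ∀ k, |S.β0 k - binf| ≤ c₀ * θ ^ k) ∧ (∃ c₁, RemainderShiftRate S c₁ θ γ) :=
  NE4.scaleShiftRate_iff_split S hγ hθ0 hθ1 hAF1

end Converse

/-! ## §4 ROUND TRIP — on the β-carrier §1's minimal interface is EQUIVALENT to the node (the in-edge list is inhabited whenever N17 holds) -/

section RoundTrip

/-- **N17 FURNISHES ITS OWN MINIMAL U3 INTERFACE (kernel, by name).**  On the β-CARRIER `T4BetaReadOut.betaCarriers` (domains = step indices,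
one-point backgrounds, identity transport) the datum's β-family IS run A's functional `betaEA D.βfun` and run B's re-indexed functional
`betaEB D.βfun b`, read off by evaluation `betaRead`: `NE4OnData D c θ γ` (`θ > 0`) gives N18 for that pair at every `b ∈ ]0,γ]` with constant `c∕θ`
(`ne5_beta_of_scaleShiftRate`), and the (D4) binders hold there identically (`representsA_beta`, `representsB_beta`, `readCovariant_beta`, window =
`Window γ`).  So §1's antecedent is satisfiable as soon as its conclusion is — the U3 road smuggles no strength and is not vacuous. [folklore] -/
theorem ne5_readOut_of_N17 (D : FiniteEpsData F G) {c θ γ : ℝ} (hθ : 0 < θ) (h : NE4OnData D c θ γ) :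
    (∀ b, 0 < b → b ≤ γ → NE5 (betaEA D.βfun) (betaEB D.βfun b) (Window γ) 0 θ (c / θ)) ∧
      RepresentsA (betaEA D.βfun) betaRead γ D.βfun ∧ RepresentsB (betaEB D.βfun) betaRead γ D.βfun ∧
      ReadCovariant betaRead betaRead 0 1 :=
  ⟨fun _ hb0 hbγ => ne5_beta_of_scaleShiftRate hθ h hb0 hbγ, representsA_beta D.βfun γ, representsB_beta D.βfun γ,
    readCovariant_beta⟩

/-- **N17 ⟺ N18 ON THE β-CARRIER (kernel).**  For `θ > 0`: `NE4OnData D c θ γ` iff row NE5 holds for (`betaEA D.βfun`, `betaEB D.βfun b`) at every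
`b ∈ ]0,γ]` on the window `Window γ` with weight `0`, rate `θ`, constant `c∕θ` — `⟸` is §1's road with `cr = 1` (`scaleShiftRate_of_ne5`, round-trip
constant `1·(c∕θ)·θ = c`).  N17 ≡ «NE5 on the β-carrier»: the node and its minimal in-edge interface have the same strength. [folklore] -/
theorem N17_iff_ne5_on_betaCarrier (D : FiniteEpsData F G) {c θ γ : ℝ} (hθ : 0 < θ) :
    NE4OnData D c θ γ ↔ ∀ b, 0 < b → b ≤ γ → NE5 (betaEA D.βfun) (betaEB D.βfun b) (Window γ) 0 θ (c / θ) := by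
  refine ⟨fun h => (ne5_readOut_of_N17 D hθ h).1, fun h18 => ?_⟩
  show ScaleShiftRate c θ γ D.βfun
  have h := scaleShiftRate_of_ne5 (W := Window γ) (fun _ _ hv => extd_mem_window hv) h18 (representsA_beta D.βfun γ)
    (representsB_beta D.βfun γ) readCovariant_beta
  rw [roundTrip_const hθ] at h
  exact h

end RoundTrip

/-! ## §5 OUT-EDGES — what N17 buys downstream, by name -/

section OutEdges

variable {C : Carriers} {W : Set (ℕ → ℝ)} {EA : Functional C C.BgA} {EB : ℝ → Functional C C.BgB}
  {𝒜A : Set (Slice C C.BgA)} {𝒜B : Set (Slice C C.BgB)} {rA : ReadOut C C.BgA} {rB : ReadOut C C.BgB}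
  {γ κ θ C₅ C₉ ω cr ρ b β' : ℝ} {k₀ : ℕ} {Λ : ℕ → ℕ → ℝ}

/-- **N17 → N27, END TO END FROM THE GLUE's IN-EDGE LIST (kernel, by name).**  (D4) ∧ N18 ∧ N22 on the `γ`-boxes (§1), the asymptotic-freedom
binders of node U2 — an eventual lower bound `EventualLowerH b γ k₀ D.βfun` (`b > 0`) and the printed-type upper bound `BetaUpperH β′ γ D.βfun` with
`γ²β′ < 1` (to run (0.20) forward) — and the window `cr·C₉·ω·((k₀+1)γ³ + 2γ∕b) ≤ (1−ρ)∕2` (`0 < ρ < 1`) give node U2's OUTPUT UNDER THE TARGETS' PREFIX: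
`D.UnderHypotheses Hβ (fun g₀ ↦ U2Output D g₀ (2(cr·C₅·θ)∕(1−ρ)) ρ)` — the geometric, K-uniform matching of the running couplings of consecutive tuned
runs, node U6's ∕ N27's input (`Spine.NE4.Targets.u2Output_under` ∘ `u2Inputs_of_u3edge`).  Every β-side binder UNPRINTED. [folklore] -/
theorem u2Output_under_of_u3edge (D : FiniteEpsData F G) {Hβ : Prop}
    (hW : ∀ k (v : Fin (k + 1) → ℝ), v ∈ Box γ k → extd v ∈ W)
    (h18 : ∀ b, 0 < b → b ≤ γ → NE5 EA (EB b) W κ θ C₅) (h22 : NE9 EA W κ Λ ∧ T4OutputRate.FadingMemory C₉ ω Λ)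
    (hA : RepresentsA EA rA γ D.βfun) (hB : RepresentsB EB rB γ D.βfun)
    (h𝒜A : ∀ g ∈ W, EA g ∈ 𝒜A) (h𝒜B : ∀ b, 0 < b → b ≤ γ → ∀ g ∈ W, EB b g ∈ 𝒜B)
    (hr : ReadBoundedOn 𝒜A rA κ cr) (hcov : ReadCovariantOn 𝒜A 𝒜B rA rB κ cr) (hcr : 0 ≤ cr) (hC₅ : 0 ≤ C₅)
    (hθ : 0 ≤ θ) (hω : 0 ≤ ω) (hθρ : θ ≤ ρ) (hωρ : ω ≤ ρ) (hρ0 : 0 < ρ) (hρ1 : ρ < 1) (hγ : 0 < γ) (hb : 0 < b)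
    (hlo : EventualLowerH b γ k₀ D.βfun) (hhi : BetaUpperH β' γ D.βfun) (hγβ : γ ^ 2 * β' < 1)
    (hsmall : cr * C₉ * ω * (((k₀ : ℝ) + 1) * γ ^ 3 + 2 * γ / b) ≤ (1 - ρ) / 2) :
    D.UnderHypotheses Hβ fun g₀ => U2Output D g₀ (2 * (cr * C₅ * θ) / (1 - ρ)) ρ :=
  have hC₉ : 0 ≤ C₉ := T4BetaReadOut.fadingMemory_const_nonneg h22.2
  NE4.u2Output_under D (u2Inputs_of_u3edge D hW h18 h22 hA hB h𝒜A h𝒜B hr hcov hcr hC₅ hθ hω hθρ hωρ) hγ hb hρ0 hρ1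
    (mul_nonneg (mul_nonneg hcr hC₅) hθ) (mul_nonneg (mul_nonneg hcr hC₉) hω) hlo hhi hγβ hsmall

/-- **SIDE EDGE N17 → N25 (END ∕ binder B3), by name.**  With the printed one-loop split `S` of `D.βfun`, the corner bound (AF-1) with `Cr·γ₀ ≤ b₀`, a
one-loop FLOOR `b₀ ≤ β⁰_{k+1}`, joint continuity (C) and the printed-type upper bound (U), `NE4OnData D c θ γ₀` (`0 ≤ θ < 1`) gives
`DagBinding.EndpointExistence D.C.toB12` ([Balaban1987RG1] Thm 2's endpoint half: for every small `g` and every `K` a bare coupling whose run stays in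
`]0,γ]` and ends at `g_K = g`) — `Spine.NE4.EndpointFromNE4.endpointExistence_of_ne4OnData` verbatim (recorded edge; the kernel apex does not use it).
Every input a BINDER; B3 is NOT thereby discharged. [cite: Balaban1987RG1, Thm 2 p.259] -/
theorem endpointExistence_of_N17 (D : FiniteEpsData F G) (S : B12Beta.OneLoopSplit D.βfun) {c θ' γ₀ Cr β₁ b₀ : ℝ}
    (hγ₀ : 0 < γ₀) (hθ0 : 0 ≤ θ') (hθ1 : θ' < 1) (h : NE4OnData D c θ' γ₀)
    (hAF1 : ∀ k (p : Fin (k + 1) → ℝ), p ∈ Box γ₀ k → |S.β1 k p| ≤ Cr * p (Fin.last k))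
    (hCr : 0 ≤ Cr) (hfloor : ∀ k, b₀ ≤ S.β0 k) (hγb : Cr * γ₀ ≤ b₀)
    (hβ₁ : 0 ≤ β₁) (hcont : BetaContH γ₀ D.βfun) (hup : BetaUpperH β₁ γ₀ D.βfun) :
    DagBinding.EndpointExistence D.C.toB12 :=
  NE4.endpointExistence_of_ne4OnData D S hγ₀ hθ0 hθ1 h hAF1 hCr hfloor hγb hβ₁ hcont hup

/-- **N17 + REGULARITY ALREADY GIVE EVERYTHING NODE U2 OWES (kernel, by name: `Spine.NE4.MinimalInterface.nodeU2_minimal`).**  From `NE4OnData D c θ γᵤ`,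
relative real-analytic charts `NE4.LocalAnalyticRel B γᵤ ρ D.βfun` of the REAL one-coupling β-sections (radius `ρ·g`, NO analyticity at `g = 0` — the
small-field domain SHAPE of [Balaban1988RG2Cluster] (1.34); printed TYPE for the last coupling, [Balaban1987RG1] p. 264; uniformity UNPRINTED), the
printed-type upper bound with `γᵤ²β′ < 1` and rates `θ < θ′ < ρ′ < 1`: (i) node U6's ∕ N27's input under the targets' prefix
`D.UnderHypotheses Hβ (fun g₀ ↦ U2Output D g₀ (2c∕(1−ρ′)) ρ′)`, (ii) [Balaban1987RG1] Thm 2's tuned bare coupling UNIQUE below an explicit threshold,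
(iii) the ∃ ⇒ ∀ passage of the targets — with NO `EventualLowerH`, NO window binder and NO row NE9: on this road N22's β-side role is ABSORBED by N17 +
regularity (the companions are DERIVED, module `Spine/NE4/FadingFromRateRelAnalytic`, `NE4.histLipschitzLog_fadingMemory_of_localAnalyticRel`).  Every input a BINDER. [cite: Balaban1987RG1, Thm 2 p.259 and §1 p.264] -/
theorem nodeU2_of_N17 (D : FiniteEpsData F G) {Hβ : Prop} {cc : (ℕ → ℝ) → Prop} {c θ₁ θ' ρ' γu ρ₁ B β₁ : ℝ}
    (hN : NE4OnData D c θ₁ γu) (hL : NE4.LocalAnalyticRel B γu ρ₁ D.βfun) (hhi : BetaUpperH β₁ γu D.βfun) (hγβ : γu ^ 2 * β₁ < 1)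
    (hc : 0 ≤ c) (hθ0 : 0 < θ₁) (hθ1 : θ₁ < 1) (hB : 0 < B) (hρ : 0 < ρ₁) (hρ1 : ρ₁ ≤ 1) (hγu : 0 < γu)
    (hθθ' : θ₁ < θ') (hθ'ρ' : θ' < ρ') (hρ'1 : ρ' < 1) :
    (D.UnderHypotheses Hβ fun g₀ => U2Output D g₀ (2 * c / (1 - ρ')) ρ') ∧
      T4TwoRunUniqueness.TunedUniqueBelow D
          (min γu (min 1 ((1 - θ') ^ 2 / (4 * (NE4.relAnalyticFading c θ₁ B ρ₁ θ' + 1))))) ∧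
      (D.UnderHypothesesE Hβ cc → D.UnderHypotheses Hβ cc) :=
  NE4.nodeU2_minimal D hN hL hhi hγβ hc hθ0 hθ1 hB hρ hρ1 hγu hθθ' hθ'ρ' hρ'1

end OutEdges

/-! ## §6 LOCATED NEGATIVES AND VACUITY FACTS at the datum, by name -/

section Negatives

open Literature.MathematicalPhysics.QuantumFieldTheory.Balaban1983to89.Beta.AveragedAFCarrier.Osc (betaO cont_and_bounds)
open Literature.MathematicalPhysics.QuantumFieldTheory.Balaban1983to89.Beta.CouplingMatchingCarrier.Osc
  (not_scaleShiftRate)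

/-- **N17 IS NOT IMPLIED BY THE β-WINDOW SIDE OF THE DAG (kernel, by name).**  For ANY datum whose β-family is the history-free oscillating family
`β_{k+1} = s + c·(−1)^k` (`Beta.AveragedAFCarrier.Osc.betaO s c`, `0 < c`): N17 FAILS for EVERY constant `c′` and EVERY rate `θ < 1` on every box
`γ > 0` — consecutive scales differ by `2c` at fixed couplings (`Beta.CouplingMatchingCarrier.Osc.not_scaleShiftRate`). [folklore] -/
theorem not_N17_of_oscillating (D : FiniteEpsData F G) {s c θ γ : ℝ} (hD : D.βfun = betaO s c) (hc : 0 < c)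
    (hθ1 : θ < 1) (hγ : 0 < γ) (c' : ℝ) : ¬ NE4OnData D c' θ γ := by
  unfold NE4OnData
  rw [hD]
  exact not_scaleShiftRate hc hθ1 hγ c'

/-- … although such a datum carries EVERY β-SIDE GRADE the flow ∕ END nodes consume («Theorem 2 as printed» grade): a positive lower bound
`BetaLowerH (s − c) γ` (`c ≤ s`; `Osc.betaLowerH`), the printed-type upper bound `BetaUpperH (s + c) γ` and joint continuity `BetaContH γ`
(`Osc.cont_and_bounds`).  So N17 is a node GENUINELY SEPARATE from N25 ∕ B3 ∕ B4 ∕ the β-window: no β-side grade of road (1) reaches it. [folklore] -/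
theorem oscillating_betaWindow (D : FiniteEpsData F G) {s c γ : ℝ} (hD : D.βfun = betaO s c) (hs : 0 ≤ s) (hc : 0 ≤ c) :
    BetaLowerH (s - c) γ D.βfun ∧ BetaUpperH (s + c) γ D.βfun ∧ BetaContH γ D.βfun := by
  rw [hD]
  obtain ⟨hcont, hup, _⟩ := cont_and_bounds hs hc γ
  exact ⟨Beta.CouplingMatchingCarrier.Osc.betaLowerH s c γ hc, hup, hcont⟩

/-- **JUNK-DATUM VACUITY (kernel).**  At a datum whose β-functions vanish identically (e.g. the tree's junk datum `T4FiniteEpsInhabited.stubData`, whose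
`βfun` is `zeroHBeta`) N17 holds with ANY constant `c ≥ 0` at any rate `θ ≥ 0` — the node has content only where the β-functions are Bałaban's (the
Stage-5 record predicate of R422; why no closed K4 item is typed over a Stage-≤3 frame). [folklore] -/
theorem N17_of_betaZero (D : FiniteEpsData F G) (hD : ∀ k (v : Fin (k + 1) → ℝ), D.βfun k v = 0) {c θ : ℝ} (γ : ℝ)
    (hc : 0 ≤ c) (hθ : 0 ≤ θ) : NE4OnData D c θ γ := by
  intro k w _
  rw [hD, hD, sub_zero, abs_zero]
  exact mul_nonneg hc (pow_nonneg hθ k)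

/-- **MONOTONICITY IN THE LETTERS (kernel)** — how the K4 record's letters are matched: N17 restricts to smaller boxes (`FlowStep.box_mono`) and
survives worsening of constant and rate (`0 ≤ c ≤ c′`, `0 ≤ θ ≤ θ′`). [folklore] -/
theorem N17_mono (D : FiniteEpsData F G) {c c' θ θ' γ γ' : ℝ} (h : NE4OnData D c θ γ') (hγ : γ ≤ γ') (hc : 0 ≤ c)
    (hcc' : c ≤ c') (hθ : 0 ≤ θ) (hθθ' : θ ≤ θ') : NE4OnData D c' θ' γ := by
  intro k w hw
  have h1 : |D.βfun (k + 1) w - D.βfun k (Fin.tail w)| ≤ c * θ ^ k := h k w (box_mono hγ (k + 1) hw)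
  calc |D.βfun (k + 1) w - D.βfun k (Fin.tail w)| ≤ c * θ ^ k := h1
    _ ≤ c' * θ' ^ k := mul_le_mul hcc' (pow_le_pow_left₀ hθ hθθ' k) (pow_nonneg hθ k) (hc.trans hcc')

end Negatives

end Summit.QuantumFields.YangMills.Theorems.BalabanUVNodesN17

end
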